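import Summits.BirchSwinnertonDyer.BirchSwinnertonDyer.Theorems.EisensteinPrimesMazurMCOnCellBTypeAPeriodQuotient
import Summits.BirchSwinnertonDyer.BirchSwinnertonDyer.Theorems.EisensteinPrimesMazurMCOnX1RankZeroLocate
import Literature.NumberTheory.EllipticCurves.TateCurve.NumberFieldUniformization
import Literature.NumberTheory.EllipticCurves.TateCurve.NumberFieldUniformizationTwisted
import HarnessLib

/-!
# Crux `MazurMCOnCellB` (stmt-BirchSwinnertonDyer-19033), line `mudescent`, stub
# `stub_analyticMuZero_offLocus` — helper 3: the type-A period ladder — the ÉTALE END of a type-A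
# Eisenstein isogeny class has the `p`-adically MAXIMAL Néron real period (cell `bsd-eis`, seat
# `bsd-eis-mu-a`, PART 1b seat (1))

Third part of the reduction «the off-locus member minimises `μ_an` in its class» of the registered
stub (skeleton `mudescent` v2). With helpers 1–2 (`…TypeAPeriodStep`, `…TypeAPeriodQuotient`: the
Vélu quotient by an UNRAMIFIED-EVEN rational `p`-line has `p · Ω(E') = u · Ω(E)`, `|u|_p = 1`):
* §1 Galois lemmas complementary to the tree's: odd kernel line ⇒ even image line; unramified image
  line ⇒ ramified kernel line (given the inertia line (hL) at one prime above `p`).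
* §2 ONE STEP for an ARBITRARY `ℚ`-isogeny of globally minimal curves at an odd good-ordinary-or-
  multiplicative prime: unramified-even kernel ⇒ `p · Ω(E') = u · Ω(E)`; ramified-odd kernel ⇒
  `Ω(E') = u · p · Ω(E)` (DUAL trick: `ker ψ̂ = ψ(E[p])` is unramified-even); `|u|_p = 1`.
* §3 the type `¬ GVPar` is a class invariant; off the `μ`-barrier locus (`¬ HasRamifiedOddLineAt`) a
  type-A curve has ALL rational `p`-lines unramified.
* §4 THE LADDER, by strong induction on `#ker ψ` for isogenies `ψ : W₁ → W₀` INTO an étale end `W₀`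
  (all `p`-lines unramified) from a type-A `W₁`: `Ω(W₀) = u · p^j · Ω(W₁)`, `|u|_p = 1`, `j : ℕ` —
  the `p`-part of `ker ψ` starts with a line whose image is a line of `W₀`, hence unramified, so the
  line is RAMIFIED (§1), hence ODD (type A): a `× p` step (§2). So the étale end has the `p`-adically
  LARGEST real period of its class — Stevens' minimal curve `A_min` at `p` (Invent. 98 (1989)
  Thm. 2.3), the member of Greenberg–Vatsal's Remark after Cor. (3.8) and Greenberg's Conj. 1.11
  (`11a3` at `5`: `Ω(11a3) = 5·Ω(11a1) = 25·Ω(11a2)`).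
HONEST FRAMING: kernel theorems only (no definition, no named fact); nothing here is about `μ` —
helper 4 (`…AnalyticMuOffLocus`) draws the consequences for the stub, which stays OPEN.
References: [Stevens1989] §2 Thm. 2.3, Rem. 4.14; [DokchitserLocalInvariants2015] Thm. 2, Props.
16, 18; [GreenbergVatsal2000] §3 Cor. (3.8) and the Remark after it (p. 40), §2 p. 28;
[GreenbergLNM1716] Conj. 1.11, §5; [SilvermanAEC2009] III.4.11, III.6.1; [SilvermanATAEC1994] V.5.3–4.
-/


set_option autoImplicit false

noncomputable section

open scoped Classical NumberField MatrixGroups ModularForm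

open WeierstrassCurve CongruenceSubgroup Field IsDedekindDomain NumberField
  Literature.NumberTheory.EllipticCurves Literature.NumberTheory.EllipticCurves.Rank1Residual
  Literature.NumberTheory.EllipticCurves.ModularForms Literature.NumberTheory.GaloisRepresentations
  Summit.BirchSwinnertonDyer.Rank1Residual Summit.BirchSwinnertonDyer.Rank1Residual.GVPeriod
  Summit.BirchSwinnertonDyer.BirchSwinnertonDyer.Theorems.EisensteinPrimesMazurMCOnCellBTypeAPeriodQuotient
  Summit.BirchSwinnertonDyer.BirchSwinnertonDyer.Theorems.EisensteinPrimesMazurMCOnX1RankZeroLocate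

-- `Summit.BirchSwinnertonDyer.BirchSwinnertonDyer.…`: the summit and its single sub-problem share a name (D-0017 layout).
set_option linter.dupNamespace false

namespace Summit.BirchSwinnertonDyer.BirchSwinnertonDyer.Theorems.EisensteinPrimesMazurMCOnCellBTypeAPeriodLadder

variable {W W' : WeierstrassCurve ℚ} {p : ℕ} [hp : Fact p.Prime]

/-! ## §1. Galois modules: odd kernel ⇒ even image; unramified image ⇒ ramified kernel -/

section KernelLine

variable (g : geomTorsion W (p : ℤ) →+ geomTorsion W' (p : ℤ))
  (hg : ∀ (σ : absoluteGaloisGroup ℚ) (P : geomTorsion W (p : ℤ)), g (σ • P) = σ • g P)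

include hg in
/-- **The image of an ODD kernel line is an EVEN rational line** (`g : E[p] → E'[p]` equivariant,
kernel of order `p`, `p` odd, (hc): each complex conjugation has non-zero fixed and anti-fixed points
on `E[p]`; `c = −1` on both `K` and `E[p]/K` would force `c = −1` on `E[p]`). Parity half of the
mirror of `GVPeriod.unramified_odd_range_of_ramified_even_ker`. [cite: GreenbergVatsal2000, §2 p. 28] -/
theorem lineEven_range_of_lineOdd_ker (hp2 : p ≠ 2)
    (hE : Nat.card (geomTorsion W (p : ℤ)) = p ^ 2)
    (hc : ∀ c : absoluteGaloisGroup ℚ, IsComplexConjugation (Rat.castHom ℝ) c →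
      (∃ P : geomTorsion W (p : ℤ), P ≠ 0 ∧ c • P = P) ∧
        (∃ Q : geomTorsion W (p : ℤ), Q ≠ 0 ∧ c • Q = -Q))
    (hK : Nat.card g.ker = p) (ho : LineOdd W p g.ker) :
    IsRationalLine W' p g.range ∧ LineEven W' p g.range := by
  have hΨ : IsRationalLine W' p g.range := isRationalLine_range g hg hE hK
  have hcc2 : ∀ c : absoluteGaloisGroup ℚ, IsComplexConjugation (Rat.castHom ℝ) c →
      ∀ P : geomTorsion W (p : ℤ), c • c • P = P := by
    intro c hcc P
    rw [← mul_smul, ← pow_two, hcc.sq_eq_one, one_smul]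
  refine ⟨hΨ, fun c hcc y hy ↦ ?_⟩
  rcases smul_eq_self_or_eq_neg_of_sq_eq_one hΨ hcc.sq_eq_one with hplus | hminus
  · exact hplus y hy
  · exfalso
    obtain ⟨⟨P₀, hP₀0, hP₀⟩, -⟩ := hc c hcc
    have hall : ∀ P : geomTorsion W (p : ℤ), c • P = -P := by
      intro P
      have h1 : c • g P = -(g P) := hminus (g P) (AddMonoidHom.mem_range.mpr ⟨P, rfl⟩)
      have h2 : c • P + P ∈ g.ker := by
        rw [AddMonoidHom.mem_ker, map_add, hg, h1, neg_add_cancel]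
      have h3 : c • (c • P + P) = -(c • P + P) := ho c hcc _ h2
      rw [smul_add, hcc2 c hcc P] at h3
      have h4 : (c • P + P) + (c • P + P) = 0 := by
        have hx : c • P + P = -(c • P + P) := (add_comm (c • P) P).trans h3
        nth_rewrite 2 [hx]
        exact add_neg_cancel _
      have h5 : c • P + P = 0 := eq_zero_of_add_self_eq_zero hp2 h4
      exact eq_neg_of_add_eq_zero_left h5
    have hq := hall P₀
    rw [hP₀] at hq
    exact hP₀0 (eq_zero_of_add_self_eq_zero hp2 (by nth_rewrite 2 [hq]; exact add_neg_cancel P₀))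

include hg in
/-- **If the image line is UNRAMIFIED, the kernel line is RAMIFIED** (given the inertia line (hL) at
one prime `𝔓 ∣ p`: `L ≤ E[p]`, `(σ − 1)E[p] ⊆ L` for `σ ∈ I_𝔓`, a point of `L` moved by some
`σ₀ ∈ I_𝔓`): if both were unramified, `σ₀P − P ∈ L ∩ ker g` for all `P`; `ker g = L` is fixed by
`I_𝔓`, or `L ∩ ker g = 0` and `σ₀` fixes `E[p]` — either way contradicting `σ₀`.
[cite: GreenbergVatsal2000, §2 p. 28] -/
theorem not_lineUnramifiedAt_ker_of_lineUnramifiedAt_range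
    (hL₀ : ∃ (v : HeightOneSpectrum (𝓞 ℚ)), (p : 𝓞 ℚ) ∈ v.asIdeal ∧ ∃ 𝔓 ∈ v.primesAbove,
      ∃ L : AddSubgroup (geomTorsion W (p : ℤ)), Nat.card L = p ∧
        (∀ σ ∈ 𝔓.inertia (absoluteGaloisGroup ℚ), ∀ P : geomTorsion W (p : ℤ), σ • P - P ∈ L) ∧
        (∃ σ ∈ 𝔓.inertia (absoluteGaloisGroup ℚ), ∃ P ∈ L, σ • P ≠ P))
    (hK : Nat.card g.ker = p) (hunr : LineUnramifiedAt W' p g.range) :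
    ¬ LineUnramifiedAt W p g.ker := by
  intro hku
  obtain ⟨v, hv, 𝔓, h𝔓, L, hLcard, hLsub, σ₀, hσ₀, x₀, hx₀L, hx₀ne⟩ := hL₀
  rcases line_eq_or_inf_eq_bot hK hLcard with hKL | hbot
  · exact hx₀ne (hku v hv 𝔓 h𝔓 σ₀ hσ₀ x₀ (hKL ▸ hx₀L))
  · have hfix : ∀ P : geomTorsion W (p : ℤ), σ₀ • P = P := by
      intro P
      have h1 : σ₀ • P - P ∈ g.ker := by
        rw [AddMonoidHom.mem_ker, map_sub, hg, sub_eq_zero]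
        exact hunr v hv 𝔓 h𝔓 σ₀ hσ₀ (g P) (AddMonoidHom.mem_range.mpr ⟨P, rfl⟩)
      have h2 : σ₀ • P - P ∈ g.ker ⊓ L := AddSubgroup.mem_inf.mpr ⟨h1, hLsub σ₀ hσ₀ P⟩
      rw [hbot, AddSubgroup.mem_bot] at h2
      exact sub_eq_zero.mp h2
    exact hx₀ne (hfix x₀)

end KernelLine

/-! ## §2. ONE STEP along an arbitrary isogeny whose kernel is a type-A line -/

section OneStep

variable [W.IsElliptic] [W'.IsElliptic] [W.IsGloballyMinimal] [W'.IsGloballyMinimal]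
  {N : ℕ} [NeZero N] {f : CuspForm (Gamma0 N) 2}

variable (W p) in
omit [W'.IsElliptic] [W'.IsGloballyMinimal] [NeZero N] in
/-- (hL) at ONE prime above an odd good-ordinary-or-multiplicative `p` (the `∃`-form, from the
`∀`-form `GVPeriod.exists_inertiaLine_of_goodOrd_or_mult`). [cite: SerreInventiones1972, §1.11 Prop. 11 and Cor., §1.12] -/
theorem exists_inertiaLine₁ (hp2 : p ≠ 2)
    (hred : (W.HasGoodReductionAtPrime p ∧ ¬ (p : ℤ) ∣ W.frobeniusTrace p) ∨
      W.HasMultiplicativeReductionAtPrime p) :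
    ∃ (v : HeightOneSpectrum (𝓞 ℚ)), (p : 𝓞 ℚ) ∈ v.asIdeal ∧ ∃ 𝔓 ∈ v.primesAbove,
      ∃ L : AddSubgroup (geomTorsion W (p : ℤ)), Nat.card L = p ∧
        (∀ σ ∈ 𝔓.inertia (absoluteGaloisGroup ℚ), ∀ P : geomTorsion W (p : ℤ), σ • P - P ∈ L) ∧
        (∃ σ ∈ 𝔓.inertia (absoluteGaloisGroup ℚ), ∃ P ∈ L, σ • P ≠ P) := by
  obtain ⟨v, hv⟩ :=
    Literature.NumberTheory.NumberFields.RingOfIntegers.exists_heightOneSpectrum_natCast_mem ℚ hp.out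
  obtain ⟨𝔓, h𝔓⟩ := HeightOneSpectrum.primesAbove_nonempty v
  exact ⟨v, hv, 𝔓, h𝔓, exists_inertiaLine_of_goodOrd_or_mult W p hp2 hred v hv 𝔓 h𝔓⟩

/-- **ONE STEP, unramified-even kernel, arbitrary isogeny: `p · Ω(E') = u · Ω(E)`, `|u|_p = 1`**
(globally minimal `E`, `E'`; `p` odd, good ordinary or multiplicative for `E`; `E` modular with
newform `f`; `ker ψ` a rational `p`-line UNRAMIFIED and EVEN). Helper 2 gives it for the Vélu
quotient `g`; `ψ = λ ∘ g`, `deg λ = 1`, and `λ` changes the period by a unit (`GVPeriod`).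
[cite: DokchitserLocalInvariants2015, Thm. 2 and Props. 16, 18] [cite: Stevens1989, §2] -/
theorem exists_unit_of_ker_unramified_even (hp2 : p ≠ 2)
    (hred : (W.HasGoodReductionAtPrime p ∧ ¬ (p : ℤ) ∣ W.frobeniusTrace p) ∨
      W.HasMultiplicativeReductionAtPrime p)
    (hf : IsNewformOf W f) {Φ₀ : AddSubgroup (geomTorsion W (p : ℤ))} (hΦ : IsRationalLine W p Φ₀)
    (hunr : LineUnramifiedAt W p Φ₀) (heven : LineEven W p Φ₀) (ψ : Isogeny W W')
    (hker : ψ.toAddMonoidHom.ker = Φ₀.map (geomTorsion W (p : ℤ)).subtype) :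
    ∃ u : ℚ, ‖(u : ℚ_[p])‖ = 1 ∧ (p : ℝ) * W'.realPeriodRat = (u : ℝ) * W.realPeriodRat := by
  have hpP : p.Prime := hp.out
  obtain ⟨W₂, hW₂, hW₂', g, hgker, -, u, hu, hΩ⟩ :=
    exists_quot_realPeriodRat_of_unramified_even hp2 hred hΦ hunr heven
  obtain ⟨lam, hdeg, -⟩ := exists_degree_one_of_ker_eq g ψ (hgker.trans hker.symm)
  have hiso₂ : IsIsogenous W W₂ := ⟨g⟩
  have hf₂ : IsNewformOf W₂ f := hf.of_isIsogenous hiso₂.symm_of_charZero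
  obtain ⟨u', hu', hΩ'⟩ := exists_unit_of_not_dvd_degree hf₂ lam
    (by rw [hdeg]; exact hpP.one_lt.ne' ∘ Nat.dvd_one.mp)
  refine ⟨u' * u, ?_, ?_⟩
  · rw [Rat.cast_mul, norm_mul, hu', hu, one_mul]
  · rw [hΩ', mul_left_comm, hΩ, Rat.cast_mul, mul_assoc]

/-- **ONE STEP, ramified-odd kernel: the DUAL trick — `Ω(E') = u · p · Ω(E)`, `|u|_p = 1`.** Same
setting, `ker ψ = Φ₀` RAMIFIED and ODD. The dual `ψ̂ : E' → E` (`ψ̂ ∘ ψ = [p]`) has kernel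
`ψ(E[p]) ≅ E[p]/Φ₀`, a rational `p`-line of `E'` which is UNRAMIFIED (`…Locate.lineUnramifiedAt_range_of_ker_ramified`)
and EVEN (§1); the unramified-even step for `ψ̂` gives `p · Ω(E) = v · Ω(E')`, `u = v⁻¹`. Going OUT
of a type-A curve along its ramified-odd line MULTIPLIES the period by `p` (`X₀(11) → 11a3` at `5`).
[cite: GreenbergVatsal2000, §3, Remark after Cor. (3.8) (p. 40)] [cite: SilvermanAEC2009, Thm. III.6.1] -/
theorem exists_unit_of_ker_ramified_odd (hp2 : p ≠ 2)
    (hred : (W.HasGoodReductionAtPrime p ∧ ¬ (p : ℤ) ∣ W.frobeniusTrace p) ∨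
      W.HasMultiplicativeReductionAtPrime p)
    (hf : IsNewformOf W f) {Φ₀ : AddSubgroup (geomTorsion W (p : ℤ))} (hΦ : IsRationalLine W p Φ₀)
    (hram : ¬ LineUnramifiedAt W p Φ₀) (hodd : LineOdd W p Φ₀) (ψ : Isogeny W W')
    (hker : ψ.toAddMonoidHom.ker = Φ₀.map (geomTorsion W (p : ℤ)).subtype) :
    ∃ u : ℚ, ‖(u : ℚ_[p])‖ = 1 ∧ W'.realPeriodRat = (u : ℝ) * (p : ℝ) * W.realPeriodRat := by
  have hpP : p.Prime := hp.out
  have hcard : Nat.card ψ.toAddMonoidHom.ker = p := by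
    rw [hker]; exact X2.IsogenyQuotientLine.natCard_map_subtype hΦ
  haveI : FiniteDimensional ψ.pullbackField W.geomFunctionField :=
    Isogeny.finiteDimensional_pullbackField_holds W W' ψ
  haveI : CharZero W.geomFunctionField :=
    charZero_of_injective_ringHom (algebraMap ℚ W.geomFunctionField).injective
  haveI : CharZero ψ.pullbackField := (algebraMap ψ.pullbackField W.geomFunctionField).charZero
  haveI : Algebra.IsSeparable ψ.pullbackField W.geomFunctionField :=
    Algebra.IsAlgebraic.isSeparable_of_perfectField
  obtain ⟨fd, hfd, -⟩ :=
    ψ.exists_dual_of_deg_le_card_ker ((ψ.deg_le_card_ker_iff_isSeparable).mpr inferInstance)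
  rw [hcard] at hfd
  have hfd' : ∀ P : geomPoints W, fd (ψ P) = (p : ℤ) • P := fun P ↦ by
    rw [hfd P, natCast_zsmul]
  obtain ⟨g, hgval, hg⟩ := X2.IsogenyLineType.exists_restrict_torsion (p := p) ψ
  have hK : g.ker = Φ₀ := ker_restrict_eq ψ hgval hker
  have hKcard : Nat.card g.ker = p := by rw [hK]; exact hΦ.1
  obtain ⟨hline, hunr'⟩ := lineUnramifiedAt_range_of_ker_ramified g hg
    (Rank1Residual.natCard_geomTorsion W p) (exists_inertiaLine₁ W p hp2 hred) hKcard (hK ▸ hram)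
  obtain ⟨-, heven'⟩ := lineEven_range_of_lineOdd_ker g hg hp2 (Rank1Residual.natCard_geomTorsion W p)
    (exists_fixed_and_antifixed_of_isComplexConjugation W hp2) hKcard (hK ▸ hodd)
  have hkerfd : fd.toAddMonoidHom.ker = g.range.map (geomTorsion W' (p : ℤ)).subtype :=
    ker_dual_eq_map_range ψ fd hfd' hgval
  have hiso : IsIsogenous W W' := ⟨ψ⟩
  have hred' := goodOrd_or_mult_of_isIsogenous (p := p) hiso hred
  have hf' : IsNewformOf W' f := hf.of_isIsogenous hiso.symm_of_charZero
  obtain ⟨v, hv, hΩ⟩ := exists_unit_of_ker_unramified_even hp2 hred' hf' hline hunr' heven' fd hkerfd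
  have hv0 : (v : ℚ_[p]) ≠ 0 := fun h ↦ by rw [h, norm_zero] at hv; exact zero_ne_one hv
  have hv0' : v ≠ 0 := fun h ↦ hv0 (by rw [h, Rat.cast_zero])
  have hvR : (v : ℝ) ≠ 0 := by exact_mod_cast hv0'
  refine ⟨v⁻¹, ?_, ?_⟩
  · rw [Rat.cast_inv, norm_inv, hv, inv_one]
  · rw [Rat.cast_inv, mul_assoc, hΩ, ← mul_assoc, inv_mul_cancel₀ hvR, one_mul]

end OneStep

/-! ## §3. Type A along isogenies; off the locus = the étale end -/

section TypeA

/-- The TYPE (`GVPar` / `¬ GVPar`) is constant along a `ℚ`-isogeny of globally minimal curves at an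
odd good-ordinary (`gvPar_iff_of_isIsogenous_of_not_dvd_frobeniusTrace`) or multiplicative
(`X2.gvPar_iff_of_isIsogenous_of_mult`, Tate uniformisation DISCHARGED) prime.
[cite: GreenbergVatsal2000, Thm. (1.3) and §2 p. 28] [cite: SilvermanATAEC1994, Thm. V.5.3 and Cor. V.5.4] -/
theorem gvPar_iff_of_isIsogenous_of_goodOrd_or_mult [W.IsElliptic] [W'.IsElliptic]
    [W.IsGloballyMinimal] [W'.IsGloballyMinimal] (hp2 : p ≠ 2)
    (hred : (W.HasGoodReductionAtPrime p ∧ ¬ (p : ℤ) ∣ W.frobeniusTrace p) ∨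
      W.HasMultiplicativeReductionAtPrime p)
    (h : IsIsogenous W W') : GVPar W p ↔ GVPar W' p := by
  rcases hred with ⟨hgood, hord⟩ | hmult
  · exact gvPar_iff_of_isIsogenous_of_not_dvd_frobeniusTrace hp2 hgood hord
      ((h.hasGoodReductionAtPrime_iff p).mp hgood) ((h.not_dvd_frobeniusTrace_iff p hgood).mp hord) h
  · exact X2.gvPar_iff_of_isIsogenous_of_mult TateCurve.Silverman1994_thmV53_tateUniformisation_holds
      TateCurve.Silverman1994_thmV53_corV54_tateUniformisation_holds hp2 hmult h

/-- **Off the `μ`-barrier locus on a type-A class = the étale end**: `¬ GVPar W p` (every rational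
`p`-line is unramified-even or ramified-odd, `coType_of_not_gvPar`) and `¬ HasRamifiedOddLineAt W p`
give: EVERY rational `p`-line of `W` is unramified. [cite: GreenbergLNM1716, Prop. 5.7 (p. 113) and Conj. 1.11 (p. 58)] -/
theorem forall_lineUnramifiedAt_of_not_gvPar_of_not_hasRamifiedOddLineAt
    (hnpar : ¬ GVPar W p) (hoff : ¬ Literature.Barriers.BirchSwinnertonDyer.HasRamifiedOddLineAt W p) :
    ∀ Φ : AddSubgroup (geomTorsion W (p : ℤ)), IsRationalLine W p Φ → LineUnramifiedAt W p Φ := by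
  intro Φ hΦ
  rcases coType_of_not_gvPar hΦ hnpar with ⟨hu, -⟩ | ⟨hr, ho⟩
  · exact hu
  · exact absurd ⟨Φ, hΦ, hr, ho⟩ hoff

end TypeA

/-! ## §4. The ladder: the étale end has the `p`-adically maximal real period -/

section Ladder

variable {N : ℕ} [NeZero N] (f : CuspForm (Gamma0 N) 2)

/-- **The ladder, by strong induction on `#ker ψ`.** `W₁` globally minimal, good ordinary or
multiplicative at the odd `p`, TYPE A (`¬ GVPar W₁ p`), modular with newform `f`; `W₀` globally
minimal with all rational `p`-lines UNRAMIFIED; `ψ : W₁ → W₀`. Then `Ω(W₀) = u · p^j · Ω(W₁)`,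
`|u|_p = 1`, `j : ℕ`. Cases: `p ∤ #ker ψ` (`j = 0`); `W₁[p] ⊆ ker ψ` (`ψ = λ ∘ [p]`); else
`Φ₀ = ker ψ ∩ W₁[p]` is a rational line whose image is a line of `W₀`, unramified, so `Φ₀` is
ramified (§1) and odd (`coType_of_not_gvPar`); `ψ = λ ∘ g`, `g : W₁ → W₁/Φ₀` a `× p·unit` step
(§2), the hypotheses pass to `W₁/Φ₀`, `#ker λ = #ker ψ / p`.
[cite: Stevens1989, Thm. 2.3 (§2)] [cite: DokchitserLocalInvariants2015, Thm. 2] -/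
theorem exists_unit_pow_of_isogeny_to_etaleEnd_aux (hp2 : p ≠ 2) (n : ℕ) :
    ∀ (W₁ W₀ : WeierstrassCurve ℚ) (_ : W₁.IsElliptic) (_ : W₀.IsElliptic)
      (_ : W₁.IsGloballyMinimal) (_ : W₀.IsGloballyMinimal),
      ((W₁.HasGoodReductionAtPrime p ∧ ¬ (p : ℤ) ∣ W₁.frobeniusTrace p) ∨
        W₁.HasMultiplicativeReductionAtPrime p) →
      ¬ GVPar W₁ p → IsNewformOf W₁ f →
      (∀ Φ : AddSubgroup (geomTorsion W₀ (p : ℤ)), IsRationalLine W₀ p Φ → LineUnramifiedAt W₀ p Φ) →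
      ∀ ψ : Isogeny W₁ W₀, ψ.degree = n →
        ∃ (u : ℚ) (j : ℕ), ‖(u : ℚ_[p])‖ = 1 ∧
          W₀.realPeriodRat = (u : ℝ) * (p : ℝ) ^ j * W₁.realPeriodRat := by
  induction n using Nat.strong_induction_on with
  | _ n ih =>
  intro W₁ W₀ _ _ _ _ hred hnpar hf hW₀ ψ hn
  have hpP : p.Prime := hp.out
  by_cases hpn : p ∣ n
  swap
  · obtain ⟨u, hu, hΩ⟩ := exists_unit_of_not_dvd_degree hf ψ (hn ▸ hpn)
    exact ⟨u, 0, hu, by rw [hΩ, pow_zero, mul_one]⟩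
  by_cases hall : ∀ P ∈ geomTorsion W₁ (p : ℤ), ψ P = 0
  · -- `W₁[p] ⊆ ker ψ`: `ψ = λ ∘ [p]`
    have hpK : ((p : ℤ) : ℚ) ≠ 0 := by exact_mod_cast hpP.ne_zero
    have hp0 : (p : ℤ) ≠ 0 := by exact_mod_cast hpP.ne_zero
    obtain ⟨lam, hlam⟩ := Isogeny.exists_eq_comp_zsmul_of_geomTorsion_le_ker hpK ψ hall
    have hfac : ∀ P, ψ P = lam (Isogeny.zsmul W₁ (p : ℤ) hp0 P) := fun P ↦ by
      rw [Isogeny.zsmul_apply]; exact hlam P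
    have hcount := natCard_ker_eq_mul_of_factor (Isogeny.zsmul W₁ (p : ℤ) hp0) ψ lam hfac
    have hkp : Nat.card (Isogeny.zsmul W₁ (p : ℤ) hp0).toAddMonoidHom.ker = p ^ 2 := by
      rw [Isogeny.ker_zsmul]; exact Rank1Residual.natCard_geomTorsion W₁ p
    rw [hkp] at hcount
    have hlt : lam.degree < n := by
      rw [← hn]
      change Nat.card lam.toAddMonoidHom.ker < Nat.card ψ.toAddMonoidHom.ker
      have h1 : 1 < p ^ 2 := Nat.one_lt_pow two_ne_zero hpP.one_lt
      have h2 : 0 < Nat.card lam.toAddMonoidHom.ker := lam.degree_pos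
      calc Nat.card lam.toAddMonoidHom.ker
          = Nat.card lam.toAddMonoidHom.ker * 1 := (mul_one _).symm
        _ < Nat.card lam.toAddMonoidHom.ker * p ^ 2 := Nat.mul_lt_mul_of_pos_left h1 h2
        _ = Nat.card ψ.toAddMonoidHom.ker := hcount.symm
    exact ih lam.degree hlt W₁ W₀ inferInstance inferInstance inferInstance inferInstance hred hnpar
      hf hW₀ lam rfl
  · -- `Φ₀ = ker ψ ∩ W₁[p]` is a rational line, RAMIFIED (its image is a line of `W₀`) and ODD (type A)
    obtain ⟨P₁, hP₁'⟩ := not_forall.mp hall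
    obtain ⟨hP₁, hψP₁⟩ := Classical.not_imp.mp hP₁'
    set Φ₀ := ψ.toAddMonoidHom.ker.comap (geomTorsion W₁ (p : ℤ)).subtype with hΦ₀def
    have hΦ₀ : IsRationalLine W₁ p Φ₀ :=
      isRationalLine_ker_inf_torsion ψ (hn ▸ hpn) ⟨P₁, hP₁, hψP₁⟩
    -- the restriction of `ψ` to `W₁[p]` has kernel `Φ₀` and image a rational line of `W₀`
    obtain ⟨g, hgval, hg⟩ := X2.IsogenyLineType.exists_restrict_torsion (p := p) ψ
    have hKg : g.ker = Φ₀ := by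
      ext P
      rw [AddMonoidHom.mem_ker, hΦ₀def, AddSubgroup.mem_comap, AddMonoidHom.mem_ker,
        Isogeny.coe_toAddMonoidHom, AddSubgroup.coe_subtype, ← hgval]
      exact ⟨fun h ↦ by rw [h]; rfl, fun h ↦ Subtype.ext h⟩
    have hKcard : Nat.card g.ker = p := by rw [hKg]; exact hΦ₀.1
    have hrange : IsRationalLine W₀ p g.range :=
      isRationalLine_range g hg (Rank1Residual.natCard_geomTorsion W₁ p) hKcard
    have hram : ¬ LineUnramifiedAt W₁ p Φ₀ := hKg ▸
      not_lineUnramifiedAt_ker_of_lineUnramifiedAt_range g hg (exists_inertiaLine₁ W₁ p hp2 hred)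
        hKcard (hW₀ _ hrange)
    have hodd : LineOdd W₁ p Φ₀ := by
      rcases coType_of_not_gvPar hΦ₀ hnpar with ⟨hu, -⟩ | ⟨-, ho⟩
      · exact absurd hu hram
      · exact ho
    -- the quotient by `Φ₀` onto a minimal model, and the ramified-odd step
    obtain ⟨W₃, hW₃, hW₃', g₃, hgker, hgdeg⟩ := X2.IsogenyQuotientLine.exists_isogeny_ker_eq_line hΦ₀
    obtain ⟨u₁, hu₁, hΩ₁⟩ := exists_unit_of_ker_ramified_odd hp2 hred hf hΦ₀ hram hodd g₃ hgker
    -- `ψ = λ ∘ g₃`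
    have hle : ∀ P : geomPoints W₁, g₃ P = 0 → ψ P = 0 := by
      intro P hP
      have hmem : P ∈ g₃.toAddMonoidHom.ker := hP
      rw [hgker] at hmem
      obtain ⟨Q, hQ, rfl⟩ := hmem
      have hQ' : Q ∈ Φ₀ := hQ
      rw [hΦ₀def, AddSubgroup.mem_comap, AddMonoidHom.mem_ker] at hQ'
      exact hQ'
    obtain ⟨lam, hfac⟩ := exists_factor_of_ker_le g₃ ψ hle
    have hcount := natCard_ker_eq_mul_of_factor g₃ ψ lam hfac
    have hkg : Nat.card g₃.toAddMonoidHom.ker = p := hgdeg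
    rw [hkg] at hcount
    have hlt : lam.degree < n := by
      rw [← hn]
      change Nat.card lam.toAddMonoidHom.ker < Nat.card ψ.toAddMonoidHom.ker
      have h2 : 0 < Nat.card lam.toAddMonoidHom.ker := lam.degree_pos
      calc Nat.card lam.toAddMonoidHom.ker
          = Nat.card lam.toAddMonoidHom.ker * 1 := (mul_one _).symm
        _ < Nat.card lam.toAddMonoidHom.ker * p := Nat.mul_lt_mul_of_pos_left hpP.one_lt h2
        _ = Nat.card ψ.toAddMonoidHom.ker := hcount.symm
    -- the hypotheses for `W₃ = W₁/Φ₀`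
    have hiso₃ : IsIsogenous W₁ W₃ := ⟨g₃⟩
    have hred₃ := goodOrd_or_mult_of_isIsogenous (p := p) hiso₃ hred
    have hf₃ : IsNewformOf W₃ f := hf.of_isIsogenous hiso₃.symm_of_charZero
    have hnpar₃ : ¬ GVPar W₃ p := fun h₃ ↦
      hnpar ((gvPar_iff_of_isIsogenous_of_goodOrd_or_mult hp2 hred hiso₃).mpr h₃)
    obtain ⟨u₂, j₂, hu₂, hΩ₂⟩ := ih lam.degree hlt W₃ W₀ hW₃ inferInstance hW₃' inferInstance hred₃
      hnpar₃ hf₃ hW₀ lam rfl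
    refine ⟨u₂ * u₁, j₂ + 1, ?_, ?_⟩
    · rw [Rat.cast_mul, norm_mul, hu₂, hu₁, one_mul]
    · rw [hΩ₂, hΩ₁, Rat.cast_mul, pow_succ]; ring

/-- **The étale end of a type-A class has the `p`-adically MAXIMAL real period** (Stevens' `A_min`
at `p`): `W₁` good ordinary or multiplicative at the odd `p`, type A, modular with newform `f`; every
rational `p`-line of `W₀` unramified; `IsIsogenous W₁ W₀` ⇒ `Ω(W₀) = u · p^j · Ω(W₁)`, `|u|_p = 1`.
[cite: Stevens1989, Thm. 2.3 (§2) and Rem. 4.14] [cite: GreenbergVatsal2000, §3, Remark after Cor. (3.8) (p. 40)] -/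
theorem exists_unit_pow_of_isIsogenous_etaleEnd {W₁ W₀ : WeierstrassCurve ℚ} [W₁.IsElliptic]
    [W₀.IsElliptic] [W₁.IsGloballyMinimal] [W₀.IsGloballyMinimal] {f : CuspForm (Gamma0 N) 2}
    (hp2 : p ≠ 2)
    (hred : (W₁.HasGoodReductionAtPrime p ∧ ¬ (p : ℤ) ∣ W₁.frobeniusTrace p) ∨
      W₁.HasMultiplicativeReductionAtPrime p)
    (hnpar : ¬ GVPar W₁ p) (hf : IsNewformOf W₁ f)
    (hW₀ : ∀ Φ : AddSubgroup (geomTorsion W₀ (p : ℤ)), IsRationalLine W₀ p Φ → LineUnramifiedAt W₀ p Φ)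
    (hiso : IsIsogenous W₁ W₀) :
    ∃ (u : ℚ) (j : ℕ), ‖(u : ℚ_[p])‖ = 1 ∧
      W₀.realPeriodRat = (u : ℝ) * (p : ℝ) ^ j * W₁.realPeriodRat := by
  obtain ⟨ψ⟩ := hiso
  exact exists_unit_pow_of_isogeny_to_etaleEnd_aux f hp2 ψ.degree W₁ W₀ inferInstance inferInstance
    inferInstance inferInstance hred hnpar hf hW₀ ψ rfl

end Ladder

end Summit.BirchSwinnertonDyer.BirchSwinnertonDyer.Theorems.EisensteinPrimesMazurMCOnCellBTypeAPeriodLadder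

end
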